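import Mathlib
import Summits.AnomalousDissipation.AnomalousDissipation.Theses.Neg
import Summits.AnomalousDissipation.AnomalousDissipation.Theorems.CoherentStatesSteadyNegTameOffThinSets
import Summits.AnomalousDissipation.AnomalousDissipation.Theorems.NegSteadyThinSetLiouvilleField

/-!
# The thin-set Liouville lemma for steady forced Euler (stmt-AnomalousDissipation-1047)

Support file for stmt-AnomalousDissipation-1049 (`SteadyNegTameOffThinSets`, routes
CoherentStates / Neg), proving the route-`Neg` declaration `SteadyThinSetLiouville`
(stmt-AnomalousDissipation-1047) on which the glue
`CoherentStates.steadyNegTameOffThinSets_of_thinSetLiouville` rests: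

> `f` continuous on `T³`; `S` closed with `volume S_ρ ≤ C ρ²` for all `ρ > 0`; `U ∈ L²`;
> `U`, `P` of class `C¹` off `S` (through the lift) with `(U·∇)U + ∇P = f`, `div U = 0` off `S`.
> Then `∫ ⟪f, U⟫ = 0`.

PROOF (Eulerian; no geometric measure theory). Off `S` the Bernoulli head `B = ½|U|² + P`
satisfies `U·∇B = ⟪f, U⟫` (part C). For the bounded profiles `h_c(s) = c·arctan(s/c)`
(`|h_c| ≤ cπ/2`, `h_c' = w_c = (1 + s²/c²)⁻¹ ∈ (0,1]`, `w_c → 1` as `c → ∞`) and the smooth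
cut-offs `χ_r` of part B built on the distance to `S` (`χ_r = 0` near `S`, `= 1` off `S_{3r}`,
`‖Dχ_r‖ ≤ r⁻¹`), the field `χ_r h_c(B) U` is `C¹` on the whole torus, so its divergence
integrates to zero, giving `∫ χ_r w_c(B)⟪f,U⟫ = -∫ Dχ_r (h_c(B) U)` (part C). As `r → 0`:
the left side tends to `∫ w_c(B)⟪f,U⟫` (dominated convergence, `S` is null), and the right side
is `≤ (cπ/2) r⁻¹ ∫_{S_{3r}} |U| ≤ (cπ/2) [(2ε)⁻¹ ∫_{S_{3r}} |U|² + (ε/2)·9C]`, which tends to `0`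
(`r → 0`, then `ε → 0`; this is where `U ∈ L²` and the codimension-2 bound enter). Hence
`∫ w_c(B)⟪f,U⟫ = 0` for every `c`, and `c → ∞` (dominated convergence) gives `∫⟪f,U⟫ = 0`.

This reproves and extends Shvydkoy, Trans. AMS 370 (2018) = arXiv:1510.03378, §6.3 ("absence
of flux anomaly" for homogeneous Onsager-critical steady states, one profile, point singularity)
to arbitrary `C¹`-off-a-codimension-2-set steady states and continuous forces; the device of
composing the head with bounded functions replaces the Lagrangian recurrence argument of the
item text. Folklore ingredients only.
-/

set_option linter.dupNamespace false  -- `Summit.AnomalousDissipation.AnomalousDissipation` is the mandated summit/problem namespace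

noncomputable section

open MeasureTheory Metric Filter Topology Set Function
open scoped InnerProductSpace ContDiff
open Literature.Analysis.FunctionSpaces Literature.Analysis.FunctionSpaces.Torus

namespace Summit.AnomalousDissipation.AnomalousDissipation.Theorems.ThinSetLiouville

variable {d : Type*} [Fintype d] [DecidableEq d]

/-! ## A distance-like function to a closed set -/

omit [Fintype d] [DecidableEq d] in
/-- For a closed `S ⊆ T^d` there is a `1`-Lipschitz `δ ≥ 0` with `δ x = 0 ↔ x ∈ S` and
`{δ < ρ} ⊆ S_ρ` for `ρ ≤ 1` (the distance to `S` if `S ≠ ∅`, the constant `1` otherwise). [folklore] -/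
theorem exists_dist_function [Fintype d] {S : Set (UnitAddTorus d)} (hS : IsClosed S) :
    ∃ δ : UnitAddTorus d → ℝ, LipschitzWith 1 δ ∧ (∀ x, 0 ≤ δ x) ∧ (∀ x, δ x = 0 ↔ x ∈ S) ∧
      ∀ ρ : ℝ, ρ ≤ 1 → {x | δ x < ρ} ⊆ Metric.thickening ρ S := by
  by_cases hne : S.Nonempty
  · exact ⟨fun x => infDist x S, lipschitz_infDist_pt S, fun x => infDist_nonneg,
      fun x => (hS.mem_iff_infDist_zero hne).symm,
      fun ρ _ x hx => (mem_thickening_iff_infDist_lt hne).2 hx⟩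
  · refine ⟨fun _ => 1, (LipschitzWith.const (1 : ℝ)).weaken zero_le_one, fun _ => zero_le_one,
      fun x => ?_, fun ρ hρ x hx => ?_⟩
    · simp only [one_ne_zero, false_iff]
      exact fun hx => hne ⟨x, hx⟩
    · simp only [mem_setOf_eq] at hx
      exact absurd hx (not_lt.2 hρ)

/-! ## Elementary facts about the profiles `c · arctan (s / c)` -/

omit [Fintype d] [DecidableEq d] in
/-- `d/ds (c·arctan(s/c)) = (1 + (s/c)²)⁻¹` for `c > 0`. [folklore] -/
theorem hasDerivAt_mul_arctan_div {c : ℝ} (hc : 0 < c) (s : ℝ) :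
    HasDerivAt (fun s => c * Real.arctan (s / c)) (1 / (1 + (s / c) ^ 2)) s := by
  have hc' : c ≠ 0 := hc.ne'
  have h1 : HasDerivAt (fun s => s / c) (1 / c) s := (hasDerivAt_id s).div_const c
  have h2 : HasDerivAt (fun s => c * Real.arctan (s / c)) (c * (1 / (1 + (s / c) ^ 2) * (1 / c))) s :=
    h1.arctan.const_mul c
  refine h2.congr_deriv ?_
  field_simp

omit [Fintype d] [DecidableEq d] in
/-- `|c·arctan(s/c)| ≤ c·π/2` for `c ≥ 0`. [folklore] -/
theorem abs_mul_arctan_div_le {c : ℝ} (hc : 0 ≤ c) (s : ℝ) :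
    |c * Real.arctan (s / c)| ≤ c * (Real.pi / 2) := by
  rw [abs_mul, abs_of_nonneg hc]
  exact mul_le_mul_of_nonneg_left
    (abs_lt.2 ⟨Real.neg_pi_div_two_lt_arctan _, Real.arctan_lt_pi_div_two _⟩).le hc

omit [Fintype d] [DecidableEq d] in
/-- `|(1 + t²)⁻¹| ≤ 1`. [folklore] -/
theorem abs_one_div_one_add_sq_le (t : ℝ) : |1 / (1 + t ^ 2)| ≤ 1 := by
  rw [abs_of_pos (by positivity)]
  exact div_le_one_of_le₀ (by nlinarith [sq_nonneg t]) (by positivity)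

/-! ## The key lemma: `∫ w(B) ⟪f, U⟫ = 0` for bounded profiles -/

section Key

variable {U f : UnitAddTorus d → EuclideanSpace ℝ d} {P : UnitAddTorus d → ℝ} {S : Set (UnitAddTorus d)}
  {C : ℝ}

omit [DecidableEq d] in
/-- AM–GM device: `t a ≤ (2ε)⁻¹ a² + (ε/2) t²`. [folklore] -/
theorem mul_le_inv_two_mul_sq_add (t a : ℝ) {ε : ℝ} (hε : 0 < ε) :
    t * a ≤ (2 * ε)⁻¹ * a ^ 2 + ε / 2 * t ^ 2 := by
  have h2 : (2 * ε)⁻¹ * a ^ 2 + ε / 2 * t ^ 2 - t * a = (a - ε * t) ^ 2 / (2 * ε) := by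
    field_simp
    ring
  have h3 : 0 ≤ (a - ε * t) ^ 2 / (2 * ε) := by positivity
  linarith

/-- **Key lemma.** Under the hypotheses of the Liouville lemma, for a `C¹` profile `h` with
`|h| ≤ M` and continuous derivative `w`, `|w| ≤ 1`: `∫ w(½|U|² + P) ⟪f, U⟫ = 0`. [folklore] -/
theorem integral_weight_inner_eq_zero (hS : IsClosed S)
    (hthin : ∀ ρ : ℝ, 0 < ρ → volume (Metric.thickening ρ S) ≤ ENNReal.ofReal (C * ρ ^ 2))
    (hU : ContDiffOn ℝ 1 (lift U) (proj ⁻¹' Sᶜ)) (hP : ContDiffOn ℝ 1 (lift P) (proj ⁻¹' Sᶜ))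
    (hf : Continuous f) (hU2 : MemLp U 2 volume)
    (hEuler : ∀ x ∈ Sᶜ, convect U U x + Torus.gradient P x = f x)
    (hdiv : ∀ x ∈ Sᶜ, divergence U x = 0)
    {h w : ℝ → ℝ} (hh : ∀ s, HasDerivAt h (w s) s) (hw : Continuous w) (hw1 : ∀ s, |w s| ≤ 1)
    {M : ℝ} (hM : ∀ s, |h s| ≤ M) :
    ∫ x, w (2⁻¹ * ‖U x‖ ^ 2 + P x) * ⟪f x, U x⟫_ℝ = 0 := by
  have hS0 : volume S = 0 := CoherentStates.measure_eq_zero_of_thickening_le volume hthin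
  have hM0 : 0 ≤ M := (abs_nonneg _).trans (hM 0)
  set C' := max C 0 with hC'
  have hC'0 : 0 ≤ C' := le_max_right _ _
  obtain ⟨δ, hδ, hδ0, hδS, hδρ⟩ := exists_dist_function hS
  have hh1 : ContDiff ℝ 1 h := by
    rw [contDiff_one_iff_deriv]
    refine ⟨fun s => (hh s).differentiableAt, ?_⟩
    have : deriv h = w := funext fun s => (hh s).deriv
    rwa [this]
  -- continuity off `S`, integrability
  have hUc : ContinuousOn U Sᶜ := continuousOn_of_contDiffOn_lift hS.isOpen_compl hU
  have hPc : ContinuousOn P Sᶜ := continuousOn_of_contDiffOn_lift hS.isOpen_compl hP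
  have hBc : ContinuousOn (fun x => 2⁻¹ * ‖U x‖ ^ 2 + P x) Sᶜ :=
    (continuousOn_const.mul (hUc.norm.pow 2)).add hPc
  obtain ⟨Cf, hCf⟩ : ∃ Cf, ∀ x, ‖f x‖ ≤ Cf := by
    obtain ⟨Cf, hCf⟩ := isCompact_univ.exists_bound_of_continuousOn hf.continuousOn
    exact ⟨Cf, fun x => hCf x (mem_univ x)⟩
  have hUi : Integrable U volume := hU2.integrable one_le_two
  have hU2i : Integrable (fun x => ‖U x‖ ^ 2) volume := (memLp_two_iff_integrable_sq_norm hU2.1).1 hU2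
  -- scales `r k = (k+3)⁻¹ ≤ 1/3` and the cut-offs
  set r : ℕ → ℝ := fun k => ((k : ℝ) + 3)⁻¹ with hr_def
  have hr : ∀ k, 0 < r k := fun k => by positivity
  have hr3 : ∀ k, 3 * r k ≤ 1 := fun k => by
    show 3 * ((k : ℝ) + 3)⁻¹ ≤ 1
    rw [← div_eq_mul_inv, div_le_one (by positivity)]
    linarith [(Nat.cast_nonneg k : (0 : ℝ) ≤ k)]
  have hr0 : Tendsto r atTop (𝓝 0) :=
    tendsto_inv_atTop_zero.comp (tendsto_atTop_add_const_right _ 3 tendsto_natCast_atTop_atTop)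
  have hranti : ∀ {k k' : ℕ}, k ≤ k' → r k' ≤ r k := fun {k k'} hkk' => by
    show ((k' : ℝ) + 3)⁻¹ ≤ ((k : ℝ) + 3)⁻¹
    exact inv_anti₀ (by positivity) (by exact_mod_cast Nat.add_le_add_right hkk' 3)
  choose χ hχs hχ01 hχ0 hχ1 hχD hχD0 using fun k => exists_smooth_cutoff δ hδ (hr k)
  -- the integral identity for each `k`
  have hid : ∀ k, ∫ x, χ k x * (w (2⁻¹ * ‖U x‖ ^ 2 + P x) * ⟪f x, U x⟫_ℝ) =
      -∫ x, Torus.fderiv (χ k) x (h (2⁻¹ * ‖U x‖ ^ 2 + P x) • U x) := fun k =>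
    integral_cutoff_weight_inner_eq hS hS0 hU hP hf hU2 hEuler hdiv hh hw hw1 hM (hχs k)
      (fun x => abs_le.2 ⟨by linarith [(hχ01 k x).1], (hχ01 k x).2⟩) (hχD k)
      (isOpen_lt hδ.continuous continuous_const)
      (fun x hx => show δ x < r k / 2 by rw [(hδS x).2 hx]; exact half_pos (hr k))
      (fun x hx => hχ0 k x hx)
  -- (1) the left-hand sides converge to `∫ w(B) ⟪f, U⟫` (dominated convergence)
  have hlim1 : Tendsto (fun k => ∫ x, χ k x * (w (2⁻¹ * ‖U x‖ ^ 2 + P x) * ⟪f x, U x⟫_ℝ)) atTop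
      (𝓝 (∫ x, w (2⁻¹ * ‖U x‖ ^ 2 + P x) * ⟪f x, U x⟫_ℝ)) := by
    refine tendsto_integral_of_dominated_convergence (fun x => Cf * ‖U x‖) (fun k => ?_)
      (hUi.norm.const_mul Cf) (fun k => ae_of_all _ fun x => ?_) ?_
    · exact aestronglyMeasurable_of_continuousOn_compl_null hS hS0
        ((hχs k).continuous.continuousOn.mul ((hw.comp_continuousOn hBc).mul
          (hf.continuousOn.inner hUc)))
    · rw [Real.norm_eq_abs, abs_mul, abs_mul]
      calc |χ k x| * (|w (2⁻¹ * ‖U x‖ ^ 2 + P x)| * |⟪f x, U x⟫_ℝ|) ≤ 1 * (1 * (‖f x‖ * ‖U x‖)) := by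
            gcongr
            · exact abs_le.2 ⟨by linarith [(hχ01 k x).1], (hχ01 k x).2⟩
            · exact hw1 _
            · exact abs_real_inner_le_norm _ _
        _ ≤ Cf * ‖U x‖ := by
            rw [one_mul, one_mul]
            exact mul_le_mul_of_nonneg_right (hCf x) (norm_nonneg _)
    · filter_upwards [measure_eq_zero_iff_ae_notMem.1 hS0] with x hx
      have hpos : 0 < δ x := lt_of_le_of_ne (hδ0 x) fun h0 => hx ((hδS x).1 h0.symm)
      have hev : ∀ᶠ k in atTop, χ k x = 1 := by
        have ht : Tendsto (fun k => (5 / 2 : ℝ) * r k) atTop (𝓝 ((5 / 2 : ℝ) * 0)) := hr0.const_mul _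
        rw [mul_zero] at ht
        filter_upwards [ht.eventually (gt_mem_nhds hpos)] with k hk
        exact hχ1 k x (by linarith)
      refine (tendsto_const_nhds (x := w (2⁻¹ * ‖U x‖ ^ 2 + P x) * ⟪f x, U x⟫_ℝ)).congr' ?_
      filter_upwards [hev] with k hk
      rw [hk, one_mul]
  -- (2) the right-hand sides converge to `0`
  have hlim2 : Tendsto (fun k => ∫ x, Torus.fderiv (χ k) x (h (2⁻¹ * ‖U x‖ ^ 2 + P x) • U x))
      atTop (𝓝 0) := by
    -- the sets `A k = {δ < 3 r_k}`
    have hAm : ∀ k, MeasurableSet {x | δ x < 3 * r k} := fun k =>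
      (isOpen_lt hδ.continuous continuous_const).measurableSet
    have hAvol : ∀ k, (volume {x | δ x < 3 * r k}).toReal ≤ C' * (3 * r k) ^ 2 := fun k => by
      refine ENNReal.toReal_le_of_le_ofReal (by positivity) ?_
      calc volume {x | δ x < 3 * r k} ≤ volume (Metric.thickening (3 * r k) S) :=
            measure_mono (hδρ _ (hr3 k))
        _ ≤ ENNReal.ofReal (C * (3 * r k) ^ 2) := hthin _ (by linarith [hr k])
        _ ≤ ENNReal.ofReal (C' * (3 * r k) ^ 2) :=
            ENNReal.ofReal_le_ofReal (mul_le_mul_of_nonneg_right (le_max_left _ _) (sq_nonneg _))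
    -- `∫_{A k} |U|² → 0`
    have ha : Tendsto (fun k => ∫ x in {x | δ x < 3 * r k}, ‖U x‖ ^ 2) atTop (𝓝 0) := by
      have h1 := tendsto_setIntegral_of_antitone (μ := volume) (f := fun x => ‖U x‖ ^ 2) hAm
        (fun k k' hkk' x (hx : δ x < 3 * r k') => show δ x < 3 * r k by
          linarith [hranti hkk']) ⟨0, hU2i.integrableOn⟩
      have h0 : ∫ x in ⋂ k, {x | δ x < 3 * r k}, ‖U x‖ ^ 2 = 0 := by
        refine setIntegral_measure_zero _ (measure_mono_null (fun x hx => ?_) hS0)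
        simp only [mem_iInter, mem_setOf_eq] at hx
        have h3 : Tendsto (fun k => 3 * r k) atTop (𝓝 (3 * 0)) := hr0.const_mul 3
        rw [mul_zero] at h3
        have hle : δ x ≤ 0 := ge_of_tendsto' h3 fun k => (hx k).le
        exact (hδS x).1 (le_antisymm hle (hδ0 x))
      rwa [h0] at h1
    -- the bound `J k = r_k⁻¹ ∫_{A k} |U| → 0`
    have hJ : Tendsto (fun k => (r k)⁻¹ * ∫ x in {x | δ x < 3 * r k}, ‖U x‖) atTop (𝓝 0) := by
      have hJle : ∀ {ε : ℝ}, 0 < ε → ∀ k, (r k)⁻¹ * ∫ x in {x | δ x < 3 * r k}, ‖U x‖ ≤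
          (2 * ε)⁻¹ * (∫ x in {x | δ x < 3 * r k}, ‖U x‖ ^ 2) + ε / 2 * (9 * C') := by
        intro ε hε k
        have hi1 : IntegrableOn (fun x => ‖U x‖) {x | δ x < 3 * r k} volume := hUi.norm.integrableOn
        have hi2 : IntegrableOn (fun x => (2 * ε)⁻¹ * ‖U x‖ ^ 2 + ε / 2 * (r k)⁻¹ ^ 2)
            {x | δ x < 3 * r k} volume :=
          ((hU2i.const_mul _).add (integrable_const _)).integrableOn
        calc (r k)⁻¹ * ∫ x in {x | δ x < 3 * r k}, ‖U x‖
            = ∫ x in {x | δ x < 3 * r k}, (r k)⁻¹ * ‖U x‖ := (integral_const_mul _ _).symm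
          _ ≤ ∫ x in {x | δ x < 3 * r k}, ((2 * ε)⁻¹ * ‖U x‖ ^ 2 + ε / 2 * (r k)⁻¹ ^ 2) :=
              setIntegral_mono_on (hi1.const_mul _) hi2 (hAm k)
                fun x _ => mul_le_inv_two_mul_sq_add _ _ hε
          _ = (2 * ε)⁻¹ * (∫ x in {x | δ x < 3 * r k}, ‖U x‖ ^ 2) +
                (volume {x | δ x < 3 * r k}).toReal * (ε / 2 * (r k)⁻¹ ^ 2) := by
              rw [integral_add (hU2i.const_mul _).integrableOn (integrable_const _).integrableOn,
                integral_const_mul, setIntegral_const, smul_eq_mul, measureReal_def]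
          _ ≤ (2 * ε)⁻¹ * (∫ x in {x | δ x < 3 * r k}, ‖U x‖ ^ 2) +
                C' * (3 * r k) ^ 2 * (ε / 2 * (r k)⁻¹ ^ 2) := by
              gcongr
              exact hAvol k
          _ = (2 * ε)⁻¹ * (∫ x in {x | δ x < 3 * r k}, ‖U x‖ ^ 2) + ε / 2 * (9 * C') := by
              have hrk : r k ≠ 0 := (hr k).ne'
              field_simp
              ring
      rw [Metric.tendsto_atTop]
      intro η hη
      set ε : ℝ := η / (9 * C' + 1) with hε_def
      have hε : 0 < ε := by positivity
      have hεC : ε / 2 * (9 * C') < η / 2 := by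
        have h9 : 0 < 9 * C' + 1 := by positivity
        have hlt : ε * (9 * C') < η := by
          rw [hε_def, div_mul_eq_mul_div, div_lt_iff₀ h9]
          have : η * (9 * C' + 1) = η * (9 * C') + η := by ring
          linarith
        linarith
      have ha' : Tendsto (fun k => (2 * ε)⁻¹ * ∫ x in {x | δ x < 3 * r k}, ‖U x‖ ^ 2) atTop
          (𝓝 ((2 * ε)⁻¹ * 0)) := ha.const_mul _
      rw [mul_zero] at ha'
      obtain ⟨N, hN⟩ := (Metric.tendsto_atTop.1 ha') (η / 2) (half_pos hη)
      refine ⟨N, fun k hk => ?_⟩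
      have hJ0 : 0 ≤ (r k)⁻¹ * ∫ x in {x | δ x < 3 * r k}, ‖U x‖ :=
        mul_nonneg (inv_nonneg.2 (hr k).le) (integral_nonneg fun x => norm_nonneg _)
      have h1 := hN k hk
      rw [Real.dist_0_eq_abs, abs_lt] at h1
      rw [Real.dist_0_eq_abs, abs_of_nonneg hJ0]
      linarith [hJle hε k, h1.2]
    -- squeeze
    refine squeeze_zero_norm (fun k => ?_) (by simpa using hJ.const_mul M)
    calc ‖∫ x, Torus.fderiv (χ k) x (h (2⁻¹ * ‖U x‖ ^ 2 + P x) • U x)‖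
        ≤ ∫ x, ‖Torus.fderiv (χ k) x (h (2⁻¹ * ‖U x‖ ^ 2 + P x) • U x)‖ :=
          norm_integral_le_integral_norm _
      _ ≤ ∫ x, M * ((r k)⁻¹ * {x | δ x < 3 * r k}.indicator (fun x => ‖U x‖) x) := by
          refine integral_mono_of_nonneg (ae_of_all _ fun x => norm_nonneg _)
            (((hUi.norm.indicator (hAm k)).const_mul _).const_mul _) (ae_of_all _ fun x => ?_)
          dsimp only
          by_cases hx : x ∈ {x | δ x < 3 * r k}
          · rw [indicator_of_mem hx]
            calc ‖Torus.fderiv (χ k) x (h (2⁻¹ * ‖U x‖ ^ 2 + P x) • U x)‖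
                ≤ ‖Torus.fderiv (χ k) x‖ * ‖h (2⁻¹ * ‖U x‖ ^ 2 + P x) • U x‖ :=
                  ContinuousLinearMap.le_opNorm _ _
              _ = ‖Torus.fderiv (χ k) x‖ * (|h (2⁻¹ * ‖U x‖ ^ 2 + P x)| * ‖U x‖) := by
                  rw [norm_smul, Real.norm_eq_abs]
              _ ≤ (r k)⁻¹ * (M * ‖U x‖) :=
                  mul_le_mul (hχD k x) (mul_le_mul_of_nonneg_right (hM _) (norm_nonneg _))
                    (mul_nonneg (abs_nonneg _) (norm_nonneg _)) (inv_nonneg.2 (hr k).le)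
              _ = M * ((r k)⁻¹ * ‖U x‖) := by ring
          · have hx' : 3 * r k ≤ δ x := not_lt.1 hx
            rw [indicator_of_notMem hx, hχD0 k x hx', mul_zero, mul_zero]
            simp
      _ = M * ((r k)⁻¹ * ∫ x in {x | δ x < 3 * r k}, ‖U x‖) := by
          rw [integral_const_mul, integral_const_mul, integral_indicator (hAm k)]
  -- conclusion
  have hsum : Tendsto (fun k => ∫ x, χ k x * (w (2⁻¹ * ‖U x‖ ^ 2 + P x) * ⟪f x, U x⟫_ℝ)) atTop
      (𝓝 (-0)) := by
    have := hlim2.neg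
    exact this.congr fun k => (hid k).symm
  rw [neg_zero] at hsum
  exact tendsto_nhds_unique hlim1 hsum

end Key

/-! ## The Liouville lemma -/

/-- **Thin-set Liouville lemma for steady forced Euler** (general dimension): under the
hypotheses of `Neg.SteadyThinSetLiouville` on `T^d`, `∫ ⟪f, U⟫ = 0`. [folklore] -/
theorem integral_inner_eq_zero_of_thinSet {f U : UnitAddTorus d → EuclideanSpace ℝ d}
    {P : UnitAddTorus d → ℝ} {S : Set (UnitAddTorus d)} (hS : IsClosed S)
    (hthin : ∃ C : ℝ, ∀ ρ : ℝ, 0 < ρ → volume (Metric.thickening ρ S) ≤ ENNReal.ofReal (C * ρ ^ 2))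
    (hf : Continuous f) (hU2 : MemLp U 2 volume)
    (hU : ContDiffOn ℝ 1 (lift U) (proj ⁻¹' Sᶜ)) (hP : ContDiffOn ℝ 1 (lift P) (proj ⁻¹' Sᶜ))
    (hEuler : ∀ x ∈ Sᶜ, convect U U x + Torus.gradient P x = f x)
    (hdiv : ∀ x ∈ Sᶜ, divergence U x = 0) :
    ∫ x, ⟪f x, U x⟫_ℝ = 0 := by
  obtain ⟨C, hC⟩ := hthin
  have hS0 : volume S = 0 := CoherentStates.measure_eq_zero_of_thickening_le volume hC
  -- the key lemma for the profiles `(n+1)·arctan(s/(n+1))`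
  have key : ∀ n : ℕ, ∫ x, 1 / (1 + ((2⁻¹ * ‖U x‖ ^ 2 + P x) / ((n : ℝ) + 1)) ^ 2) * ⟪f x, U x⟫_ℝ = 0 := by
    intro n
    have hc : 0 < (n : ℝ) + 1 := by positivity
    exact integral_weight_inner_eq_zero hS hC hU hP hf hU2 hEuler hdiv
      (h := fun s => ((n : ℝ) + 1) * Real.arctan (s / ((n : ℝ) + 1)))
      (w := fun s => 1 / (1 + (s / ((n : ℝ) + 1)) ^ 2))
      (fun s => hasDerivAt_mul_arctan_div hc s)
      (continuous_const.div (continuous_const.add ((continuous_id.div_const _).pow 2))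
        fun s => (by positivity : (0 : ℝ) < 1 + (s / ((n : ℝ) + 1)) ^ 2).ne')
      (fun s => abs_one_div_one_add_sq_le _) (M := ((n : ℝ) + 1) * (Real.pi / 2))
      (fun s => abs_mul_arctan_div_le hc.le s)
  -- dominated convergence as `n → ∞`
  have hUc : ContinuousOn U Sᶜ := continuousOn_of_contDiffOn_lift hS.isOpen_compl hU
  have hPc : ContinuousOn P Sᶜ := continuousOn_of_contDiffOn_lift hS.isOpen_compl hP
  have hBc : ContinuousOn (fun x => 2⁻¹ * ‖U x‖ ^ 2 + P x) Sᶜ :=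
    (continuousOn_const.mul (hUc.norm.pow 2)).add hPc
  obtain ⟨Cf, hCf⟩ : ∃ Cf, ∀ x, ‖f x‖ ≤ Cf := by
    obtain ⟨Cf, hCf⟩ := isCompact_univ.exists_bound_of_continuousOn hf.continuousOn
    exact ⟨Cf, fun x => hCf x (mem_univ x)⟩
  have hUi : Integrable U volume := hU2.integrable one_le_two
  have hlim : Tendsto (fun n : ℕ => ∫ x, 1 / (1 + ((2⁻¹ * ‖U x‖ ^ 2 + P x) / ((n : ℝ) + 1)) ^ 2) *
      ⟪f x, U x⟫_ℝ) atTop (𝓝 (∫ x, ⟪f x, U x⟫_ℝ)) := by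
    refine tendsto_integral_of_dominated_convergence (fun x => Cf * ‖U x‖) (fun n => ?_)
      (hUi.norm.const_mul Cf) (fun n => ae_of_all _ fun x => ?_) (ae_of_all _ fun x => ?_)
    · refine aestronglyMeasurable_of_continuousOn_compl_null hS hS0 (ContinuousOn.mul ?_
        (hf.continuousOn.inner hUc))
      exact (continuous_const.div (continuous_const.add ((continuous_id.div_const _).pow 2))
        fun s => (by positivity : (0 : ℝ) < 1 + (s / ((n : ℝ) + 1)) ^ 2).ne').comp_continuousOn hBc
    · rw [Real.norm_eq_abs, abs_mul]
      calc |1 / (1 + ((2⁻¹ * ‖U x‖ ^ 2 + P x) / ((n : ℝ) + 1)) ^ 2)| * |⟪f x, U x⟫_ℝ|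
          ≤ 1 * (‖f x‖ * ‖U x‖) := by
            gcongr
            · exact abs_one_div_one_add_sq_le _
            · exact abs_real_inner_le_norm _ _
        _ ≤ Cf * ‖U x‖ := by
            rw [one_mul]; exact mul_le_mul_of_nonneg_right (hCf x) (norm_nonneg _)
    · have h1 : Tendsto (fun n : ℕ => (2⁻¹ * ‖U x‖ ^ 2 + P x) / ((n : ℝ) + 1)) atTop (𝓝 0) := by
        have := (tendsto_one_div_add_atTop_nhds_zero_nat (𝕜 := ℝ)).const_mul (2⁻¹ * ‖U x‖ ^ 2 + P x)
        rw [mul_zero] at this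
        exact this.congr fun n => (div_eq_mul_one_div _ _).symm
      have h2 : Tendsto (fun n : ℕ => 1 / (1 + ((2⁻¹ * ‖U x‖ ^ 2 + P x) / ((n : ℝ) + 1)) ^ 2))
          atTop (𝓝 (1 / (1 + 0 ^ 2))) :=
        tendsto_const_nhds.div ((h1.pow 2).const_add 1) (by norm_num)
      have h3 := h2.mul_const ⟪f x, U x⟫_ℝ
      have h4 : (1 : ℝ) / (1 + 0 ^ 2) * ⟪f x, U x⟫_ℝ = ⟪f x, U x⟫_ℝ := by norm_num
      rw [h4] at h3
      exact h3
  have hconst : (fun n : ℕ => ∫ x, 1 / (1 + ((2⁻¹ * ‖U x‖ ^ 2 + P x) / ((n : ℝ) + 1)) ^ 2) *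
      ⟪f x, U x⟫_ℝ) = fun _ => 0 := funext key
  rw [hconst] at hlim
  exact (tendsto_const_nhds_iff.1 hlim).symm

/-- **Settles stmt-AnomalousDissipation-1047** (`Neg.SteadyThinSetLiouville`): a steady
finite-energy Euler flow on `T³`, `C¹` off a closed set of codimension `≥ 2` in the Minkowski
sense, absorbs no power from a continuous force: `∫ ⟪f, U⟫ = 0`. [folklore] -/
theorem steadyThinSetLiouville :
    Summit.AnomalousDissipation.AnomalousDissipation.Theses.Neg.SteadyThinSetLiouville :=
  fun _f _U _P _S hS hthin hf hU2 hU hP hEuler hdiv =>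
    integral_inner_eq_zero_of_thinSet hS hthin hf hU2 hU hP hEuler hdiv

/-! ## Closing stmt-AnomalousDissipation-1049 -/

/-- **Settles stmt-AnomalousDissipation-1049** (route CoherentStates copy of
`SteadyNegTameOffThinSets`): vanishing-viscosity families of steady classical Navier–Stokes
solutions with fixed smooth force and bounded energy, converging pointwise off a codimension-2
closed set to a `C¹`-off-that-set steady Euler pair, have `ν_j ‖∇u_j‖² → 0` — the glue
`CoherentStates.steadyNegTameOffThinSets_of_thinSetLiouville` applied to the thin-set Liouville
lemma `steadyThinSetLiouville`. [folklore] -/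
theorem steadyNegTameOffThinSets_proof :
    Summit.AnomalousDissipation.AnomalousDissipation.Theses.CoherentStates.SteadyNegTameOffThinSets :=
  CoherentStates.steadyNegTameOffThinSets_of_thinSetLiouville steadyThinSetLiouville

/-- **Settles stmt-AnomalousDissipation-1049**, route-`Neg` copy of the declaration (identical
statement). [folklore] -/
theorem neg_steadyNegTameOffThinSets_proof :
    Summit.AnomalousDissipation.AnomalousDissipation.Theses.Neg.SteadyNegTameOffThinSets :=
  CoherentStates.neg_steadyNegTameOffThinSets_of_thinSetLiouville steadyThinSetLiouville

end Summit.AnomalousDissipation.AnomalousDissipation.Theorems.ThinSetLiouville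

end
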